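import Mathlib.GroupTheory.GroupAction.ConjAct
import Mathlib.FieldTheory.IsAlgClosed.AlgebraicClosure
import Literature.AnabelianGeometry.SemiGraphs.TemperedThetaQuotients
import HarnessLib

/-!
# [EtTh] §1 p. 238: the cyclotomic identifications `Δ_Θ ≅ Ẑ(1)` and `1 → Ẑ(1) → Δ^ell_X → Ẑ → 1`

Mochizuki, *The étale theta function and its Frobenioid-theoretic manifestations*, Publ. RIMS **45**
(2009), §1, printed p. 238 (PDF p. 12; kurims p. 11) [cite: MochizukiEtTh2009, §1 p.238]:
"Then we have a natural exact sequence `1 → Ẑ(1) → Δ^ell_X → Ẑ → 1` … Since `Δ_X` is a profinite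
free group on 2 generators, we also have a natural exact sequence
`1 → ∧² Δ^ell_X (≅ Ẑ(1)) → Δ^Θ_X → Δ^ell_X → 1` … Let us denote the image of `∧² Δ^ell_X` in `Δ^Θ_X`
by `(Ẑ(1) ≅) Δ_Θ ⊆ Δ^Θ_X`." These are statements about `Ẑ(1) = lim_n μ_n(K̄)` as a `G_K`-MODULE,
`G_K = Gal(K̄/K)` acting on `Δ_X` through conjugation in `Π^tp_X` (on the central subquotient `Δ_Θ`
the conjugation action of `Π^tp_X` factors through `Π^tp_X/Δ^tp_X = G_K`).

Typed here over `OncePuncturedTemperedGroup K` (`TemperedCurves.lean`) and its quotients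
(`TemperedThetaQuotients.lean`):
* the conjugation action of `Π^tp_X` on `Δ_X`, `Δ^ell_X`, `Δ^Θ_X` (`conjDeltaHat`, `conjDeltaEll`,
  `conjDeltaThetaX`) — real definitions, with `conjDeltaThetaX_mem_deltaTheta`;
* `IsTateTwist` — "the closed subgroup `T`, with its `Π^tp_X`-conjugation action, is `Ẑ(1)` as a
  `G_K`-module": a compatible, jointly injective family of continuous surjections
  `T ↠ μ_n(K̄)` (`n ≥ 1`) that is `Π^tp_X`-equivariant for `G_K` acting on `μ_n(K̄) ⊆ K̄` through
  `aug` (level-wise form of an isomorphism with `lim_n μ_n(K̄)`; it avoids fixing a model of `Ẑ`);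
* `DeltaThetaIsoTate Ω` — "`Δ_Θ ≅ Ẑ(1)`" as a predicate on the origin hypothesis `Ω` (assumed by
  consumers, asserted for no instance — see `TemperedPiOrigin`);
* `DeltaEllExtension Ω` — "`1 → Ẑ(1) → Δ^ell_X → Ẑ → 1`": a closed `Π^tp_X`-stable subgroup
  `T ≤ Δ^ell_X` which is a Tate twist, with `Π^tp_X` acting trivially on `Δ^ell_X/T` and `Δ^ell_X/T`
  torsion-free procyclic receiving `Δ^tp_X` compatibly with `Π^tp_X ↠ Z` (level-wise).

Deliberately NOT here: "`∧² Δ^ell_X ≅ Ẑ(1)`" as a statement about the exterior square (it is the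
combination of the two facts above); "`(Δ^tp_Y)^ell ≅ Ẑ(1)`" (p. 238, last line) is
`DeltaYEllIsoTate Ω` (tempered quotient) and `DeltaYEllClosureIsoTate Ω` (its closure in `Δ^ell_X`). The cyclotome as an abstract inverse limit is the [EtTh]/LANA Kummer-theory
file's (`Literature.AnabelianGeometry.EtaleTheta.cyclotome`); the level-wise statements here need
no model of it. No statement of the paper is strengthened.
-/

open Topology

noncomputable section

namespace Literature.AnabelianGeometry.SemiGraphs

namespace OncePuncturedTemperedGroup

universe u

variable {K : Type u} [Field K] (D : OncePuncturedTemperedGroup K)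

/-! ### The conjugation action of `Π^tp_X` on `Δ_X` and its quotients -/

/-- Conjugation by (the image in `Π_X` of) `g ∈ Π^tp_X` on the normal subgroup `Δ_X ⊆ Π_X`.
[cite: MochizukiEtTh2009, §1 p.238] -/
def conjDeltaHat (g : D.Pi) : D.deltaHat ≃* D.deltaHat := MulAut.conjNormal (D.toHat g)

/-- Underlying formula: `conjDeltaHat g x = ĝ x ĝ⁻¹`. [cite: MochizukiEtTh2009, §1 p.238] -/
theorem coe_conjDeltaHat (g : D.Pi) (x : D.deltaHat) :
    (D.conjDeltaHat g x : D.PiHat) = D.toHat g * x * (D.toHat g)⁻¹ :=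
  MulAut.conjNormal_apply _ _

/-- Conjugation preserves (the trace on `Δ_X` of) any normal subgroup of `Π_X`. [folklore] -/
private theorem subgroupOf_le_comap_conj (N : Subgroup D.PiHat) [N.Normal] (g : D.Pi) :
    N.subgroupOf D.deltaHat ≤ (N.subgroupOf D.deltaHat).comap (D.conjDeltaHat g).toMonoidHom := by
  intro x hx
  rw [Subgroup.mem_comap, Subgroup.mem_subgroupOf]
  change (D.conjDeltaHat g x : D.PiHat) ∈ N
  rw [coe_conjDeltaHat]
  exact ‹N.Normal›.conj_mem _ (Subgroup.mem_subgroupOf.mp hx) _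

/-- The induced action of `g ∈ Π^tp_X` on `Δ^ell_X = Δ_X/[Δ_X, Δ_X]⁻`. [cite: MochizukiEtTh2009, §1 p.238] -/
def conjDeltaEll (g : D.Pi) : D.DeltaEll →* D.DeltaEll :=
  QuotientGroup.map _ _ (D.conjDeltaHat g).toMonoidHom (D.subgroupOf_le_comap_conj D.ellKerHat g)

/-- The induced action of `g ∈ Π^tp_X` on `Δ^Θ_X = Δ_X/[Δ_X,[Δ_X,Δ_X]]⁻`. [cite: MochizukiEtTh2009, §1 p.238] -/
def conjDeltaThetaX (g : D.Pi) : D.DeltaThetaX →* D.DeltaThetaX :=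
  QuotientGroup.map _ _ (D.conjDeltaHat g).toMonoidHom
    (D.subgroupOf_le_comap_conj D.doubleCommutator g)

/-- The action of `Π^tp_X` on `Δ^Θ_X` preserves `Δ_Θ`. [cite: MochizukiEtTh2009, §1 p.238] -/
theorem conjDeltaThetaX_mem_deltaTheta (g : D.Pi) {x : D.DeltaThetaX} (hx : x ∈ D.deltaTheta) :
    D.conjDeltaThetaX g x ∈ D.deltaTheta := by
  obtain ⟨y, hy, rfl⟩ := hx
  refine ⟨D.conjDeltaHat g y, D.subgroupOf_le_comap_conj D.ellKerHat g hy, ?_⟩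
  rfl

/-- The induced action of `g ∈ Π^tp_X` on the tempered quotient `(Π^tp_X)^ell = Π^tp_X/ellKer`
(conjugation; `ellKer` is normal). [cite: MochizukiEtTh2009, §1 p.238] -/
def conjPiEll (g : D.Pi) : D.PiEll →* D.PiEll :=
  QuotientGroup.map _ _ (MulAut.conj g).toMonoidHom fun x hx => by
    rw [Subgroup.mem_comap]
    exact D.ellKer_normal.conj_mem x hx g

/-- The action of `Π^tp_X` on `(Π^tp_X)^ell` preserves `(Δ^tp_Y)^ell` (the image of the normal
subgroup `Δ^tp_Y = Δ^tp_X ∩ Π^tp_Y`). [cite: MochizukiEtTh2009, §1 p.238] -/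
theorem conjPiEll_mem_deltaYEll (g : D.Pi) {x : D.PiEll} (hx : x ∈ D.deltaYEll) :
    D.conjPiEll g x ∈ D.deltaYEll := by
  obtain ⟨y, hy, rfl⟩ := hx
  refine ⟨g * y * g⁻¹, ?_, rfl⟩
  exact ⟨D.delta_normal.conj_mem y hy.1 g, D.piY_normal.conj_mem y hy.2 g⟩

/-- `G_K = Gal(K̄/K)` acting on `K̄` ([EtTh] p. 237 "`G_K := Gal(K̄/K)`"; the group
`Field.absoluteGaloisGroup K` is by definition `K̄ ≃ₐ[K] K̄`). [cite: MochizukiEtTh2009, §1 p.237] -/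
def galApply (σ : Field.absoluteGaloisGroup K) (a : AlgebraicClosure K) : AlgebraicClosure K :=
  (show AlgebraicClosure K ≃ₐ[K] AlgebraicClosure K from σ) a

/-! ### "is `Ẑ(1)` as a `G_K`-module", level-wise -/

/-- `T ≤ A`, a subgroup of a topological group on which `Π^tp_X` acts through `act`, *is a Tate
twist* `Ẑ(1) = lim_n μ_n(K̄)`: there are continuous surjections `ι_n : T ↠ μ_n(K̄)` (`n ≥ 1`),
compatible (`ι_{nm}^m = ι_n`), jointly injective, and equivariant — `ι_n(g · t) = aug(g)(ι_n(t))`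
for `g ∈ Π^tp_X` — so that `T ≅ lim_n μ_n(K̄) = Ẑ(1)` as a topological `G_K`-module ([EtTh] p. 238,
"`Ẑ(1)`"). [cite: MochizukiEtTh2009, §1 p.238] -/
def IsTateTwist {A : Type u} [Group A] [TopologicalSpace A] (T : Subgroup A)
    (act : D.Pi → A →* A) (hact : ∀ g, ∀ t ∈ T, act g t ∈ T) : Prop :=
  ∃ ι : ℕ → (T →* (AlgebraicClosure K)ˣ),
    (∀ n, 0 < n → ∀ t : T, (ι n t) ^ n = 1) ∧
    (∀ n, 0 < n → ∀ ζ : (AlgebraicClosure K)ˣ, ζ ^ n = 1 → ∃ t : T, ι n t = ζ) ∧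
    (∀ n, 0 < n → IsOpen ((ι n).ker : Set T)) ∧
    (∀ n m, 0 < n → 0 < m → ∀ t : T, (ι (n * m) t) ^ m = ι n t) ∧
    (∀ t : T, (∀ n, 0 < n → ι n t = 1) → t = 1) ∧
    ∀ n, 0 < n → ∀ (g : D.Pi) (t : T),
      ((ι n ⟨act g t, hact g t t.2⟩ : (AlgebraicClosure K)ˣ) : AlgebraicClosure K) =
        galApply (D.aug g) ((ι n t : (AlgebraicClosure K)ˣ) : AlgebraicClosure K)

/-- **[EtTh] §1 p. 238, "`(Ẑ(1) ≅) Δ_Θ`"**, as a predicate on the origin hypothesis `Ω` (assumed by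
consumers, asserted for no instance): for the tempered fundamental group `D` of the once-punctured
elliptic curve, `Δ_Θ ⊆ Δ^Θ_X` with the conjugation action of `Π^tp_X` (which factors through `G_K`)
is a Tate twist `Ẑ(1)`. [cite: MochizukiEtTh2009, §1 p.238] -/
def DeltaThetaIsoTate (Ω : TemperedPiOrigin K) : Prop :=
  ∀ D : OncePuncturedTemperedGroup K, Ω.IsTateOrigin D →
    D.IsTateTwist D.deltaTheta D.conjDeltaThetaX (fun g _ ht => D.conjDeltaThetaX_mem_deltaTheta g ht)

/-- **[EtTh] §1 p. 238, "we have a natural exact sequence `1 → Ẑ(1) → Δ^ell_X → Ẑ → 1`"**, as a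
predicate on the origin hypothesis `Ω`: there is a closed subgroup `T ≤ Δ^ell_X`, stable under the
conjugation action of `Π^tp_X`, which is a Tate twist `Ẑ(1)`, such that `Π^tp_X` acts trivially on
`Δ^ell_X/T` and `Δ^ell_X/T ≅ Ẑ` — level-wise: compatible, jointly injective (on the quotient)
homomorphisms `λ_n : Δ^ell_X → ZMod n` killing `T`, onto, under which the image of `δ ∈ Δ^tp_X` is
`(Π^tp_X ↠ Z)(δ) mod n` (the `Ẑ`-quotient is the profinite completion of `Gal(Y/X) = Z`).
[cite: MochizukiEtTh2009, §1 p.238] -/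
def DeltaEllExtension (Ω : TemperedPiOrigin K) : Prop :=
  ∀ D : OncePuncturedTemperedGroup K, Ω.IsTateOrigin D →
    ∃ (T : Subgroup D.DeltaEll) (hT : ∀ g, ∀ t ∈ T, D.conjDeltaEll g t ∈ T),
      IsClosed (T : Set D.DeltaEll) ∧ D.IsTateTwist T D.conjDeltaEll hT ∧
      (∀ (g : D.Pi) (x : D.DeltaEll), (D.conjDeltaEll g x)⁻¹ * x ∈ T) ∧
      ∃ lam : ∀ n : ℕ, D.DeltaEll →* Multiplicative (ZMod n),
        (∀ n, 0 < n → Function.Surjective (lam n)) ∧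
        (∀ n, 0 < n → IsOpen ((lam n).ker : Set D.DeltaEll)) ∧
        (∀ n, 0 < n → T ≤ (lam n).ker) ∧
        (∀ n m, 0 < n → 0 < m → ∀ x,
          (ZMod.castHom (dvd_mul_right n m) (ZMod n)) (Multiplicative.toAdd (lam (n * m) x)) =
            Multiplicative.toAdd (lam n x)) ∧
        (∀ x, (∀ n, 0 < n → lam n x = 1) → x ∈ T) ∧
        ∀ n, 0 < n → ∀ δ : D.delta,
          lam n (QuotientGroup.mk ⟨D.toHat δ, Subgroup.le_topologicalClosure _ ⟨δ, δ.2, rfl⟩⟩) =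
            Multiplicative.ofAdd ((Multiplicative.toAdd (D.zQuot δ) : ℤ) : ZMod n)

/-- **[EtTh] §1 p. 238, last display: "Thus, `(Δ^tp_Y)^ell ≅ Ẑ(1)`"**, as a predicate on the origin
hypothesis: the tempered quotient `(Δ^tp_Y)^ell ⊆ (Π^tp_X)^ell` (`deltaYEll`, with the conjugation
action of `Π^tp_X`) is a Tate twist `Ẑ(1)` (level-wise, `IsTateTwist`).
[cite: MochizukiEtTh2009, §1 p.238] -/
def DeltaYEllIsoTate (Ω : TemperedPiOrigin K) : Prop :=
  ∀ D : OncePuncturedTemperedGroup K, Ω.IsTateOrigin D →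
    D.IsTateTwist D.deltaYEll D.conjPiEll (fun g _ hx => D.conjPiEll_mem_deltaYEll g hx)

/-- The profinite-side companion of "`(Δ^tp_Y)^ell ≅ Ẑ(1)`" (p. 238): inside `Δ^ell_X` the closure of
the image of `Δ^tp_Y` is a `Π^tp_X`-stable Tate-twist subgroup (the `Ẑ(1)` of the extension
`1 → Ẑ(1) → Δ^ell_X → Ẑ → 1`). [cite: MochizukiEtTh2009, §1 p.238] -/
def DeltaYEllClosureIsoTate (Ω : TemperedPiOrigin K) : Prop :=
  ∀ D : OncePuncturedTemperedGroup K, Ω.IsTateOrigin D →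
    ∃ (T : Subgroup D.DeltaEll) (hT : ∀ g, ∀ t ∈ T, D.conjDeltaEll g t ∈ T),
      IsClosed (T : Set D.DeltaEll) ∧ D.IsTateTwist T D.conjDeltaEll hT ∧
      (T : Set D.DeltaEll) = closure ((fun δ : D.delta =>
        (QuotientGroup.mk ⟨D.toHat δ, Subgroup.le_topologicalClosure _ ⟨δ, δ.2, rfl⟩⟩ : D.DeltaEll)) ''
          {δ | (δ : D.Pi) ∈ D.piY})

end OncePuncturedTemperedGroup

end Literature.AnabelianGeometry.SemiGraphs

end
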